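import Mathlib
import HarnessLib
import Summits.NavierStokesRegularity.NavierStokesRegularity.Theorems.UnthreadedDoorNetFluxAnalyticNormalisation

/-!
# Route `UnthreadedDoor`, crux `PoloidalLiouville` (stmt-NavierStokesRegularity-1222), WALL W1 — LINE `height_head` v2, stub HH-6a:
# `AnalyticRadialGauge` — the EXPLICIT radial gauge `T x − T (x₀ + ‖x − x₀‖ • σ₀)` is real-analytic off the centre

The registered stub HH-6a `stub_analyticRadialGauge : AnalyticRadialGauge` of ns-idea-14's line
`Cruxes/PoloidalLiouville/Lines/height_head.lean` v2 (crux write 0312d4da328d, l.894–902), proved with its binders VERBATIM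
(`analyticRadialGauge`): for `v` real-analytic on `ℝ³`, `T ∈ C^∞(ℝ³ ∖ {x₀})` with `curl v = ∇T × (x − x₀)`, and a UNIT vector
`σ₀`, the explicit gauge `x ↦ T x − T (x₀ + ‖x − x₀‖ • σ₀)` is real-analytic on `{x₀}ᶜ`.

This is the explicit form of the landed `NetFlux.analyticNormalisation` (p682202, whose `∃ T'` hides the same function for
`σ₀ = e₀`); the proof re-runs its last step for a general unit `σ₀`: off the antipodal ray of `σ₀` the landed great-circle
lemma `NetFlux.analyticOnNhd_sub_ray` (p682202) applies directly; at a general `x₁ ≠ x₀` choose a unit `σ₁` with `σ₀ + σ₁ ≠ 0`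
and `‖y₁‖ σ₁ + y₁ ≠ 0` (`exists_unit_off_two_rays`: `σ₁ = y₁/‖y₁‖`, or a coordinate vector when `y₁/‖y₁‖ = −σ₀`) and write
`T − T(x₀ + ‖y‖σ₀) = [T − T(x₀ + ‖y‖σ₁)] + (T − T(x₀ + ‖y‖σ₀)) ∘ (x ↦ x₀ + ‖x − x₀‖ σ₁)`, a sum/composition of analytic maps.

WHAT THIS IS NOT: pure real-analytic geometry; `PoloidalLiouville` (1222), the height-head targets, W1 and NS regularity stay
OPEN.  `--supports stmt-NavierStokesRegularity-1222 --as helper`.  [folklore]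
-/

noncomputable section

-- the summit and its single sub-problem share the name (CONVENTIONS §1)
set_option linter.dupNamespace false

open Set Function Filter Topology InnerProductSpace MeasureTheory Metric
open scoped RealInnerProductSpace ContDiff

namespace Summit.NavierStokesRegularity.NavierStokesRegularity.Theorems.PoloidalLiouville.NetFlux

open Literature.Analysis Literature.Analysis.FluidPDE

/-- **Choice of an auxiliary base direction.**  For a vector `σ₀` and `y ≠ 0` there is a unit vector `σ₁` with
`σ₀ + σ₁ ≠ 0` (the ray `x₀ + r σ₁` misses the antipodal ray of `σ₀`) and `‖y‖ σ₁ + y ≠ 0` (`y` misses the antipodal ray of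
`σ₁`): `σ₁ = y/‖y‖` unless `y/‖y‖ = −σ₀`, in which case a coordinate vector `≠ ±σ₀` works. [folklore] -/
theorem exists_unit_off_two_rays (σ₀ : E3) {y : E3} (hy : y ≠ 0) :
    ∃ σ₁ : E3, ‖σ₁‖ = 1 ∧ σ₀ + σ₁ ≠ 0 ∧ ‖y‖ • σ₁ + y ≠ 0 := by
  have hny : ‖y‖ ≠ 0 := norm_ne_zero_iff.2 hy
  set u : E3 := ‖y‖⁻¹ • y with hu
  have hun : ‖u‖ = 1 := by
    rw [hu, norm_smul, norm_inv, norm_norm, inv_mul_cancel₀ hny]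
  have hyu : ‖y‖ • u = y := by rw [hu, smul_inv_smul₀ hny]
  by_cases h : σ₀ + u ≠ 0
  · refine ⟨u, hun, h, ?_⟩
    rw [hyu, ← two_smul ℝ y]
    exact smul_ne_zero two_ne_zero hy
  · -- `u = -σ₀`: take a coordinate vector different from `± σ₀`
    have hu' : u = -σ₀ := by
      rw [not_not] at h
      exact (neg_eq_of_add_eq_zero_right h).symm
    set e₀ : E3 := EuclideanSpace.single 0 1 with he₀
    set e₁ : E3 := EuclideanSpace.single 1 1 with he₁
    have hne₀ : ‖e₀‖ = 1 := by simp [he₀]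
    have hne₁ : ‖e₁‖ = 1 := by simp [he₁]
    have h10 : e₁ ≠ e₀ := by
      intro h'
      have := congrArg (fun w : E3 => w 1) h'
      simp [he₀, he₁] at this
    have h10' : e₁ ≠ -e₀ := by
      intro h'
      have := congrArg (fun w : E3 => w 1) h'
      simp [he₀, he₁] at this
    -- a candidate `e ≠ ± σ₀`
    obtain ⟨e, hen, he1, he2⟩ : ∃ e : E3, ‖e‖ = 1 ∧ e ≠ σ₀ ∧ e ≠ -σ₀ := by
      by_cases h1 : e₀ ≠ σ₀ ∧ e₀ ≠ -σ₀
      · exact ⟨e₀, hne₀, h1.1, h1.2⟩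
      · refine ⟨e₁, hne₁, ?_, ?_⟩
        · intro h2
          rcases not_and_or.1 h1 with h3 | h3
          · exact h10 (h2.trans (not_not.1 h3).symm)
          · have h4 : e₀ = -σ₀ := not_not.1 h3
            exact h10' (by rw [h4, neg_neg]; exact h2)
        · intro h2
          rcases not_and_or.1 h1 with h3 | h3
          · exact h10' (by rw [(not_not.1 h3)]; exact h2)
          · have h4 : e₀ = -σ₀ := not_not.1 h3
            exact h10 (h2.trans h4.symm)
    refine ⟨e, hen, fun h' => he2 (neg_eq_of_add_eq_zero_right h').symm, fun h' => he1 ?_⟩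
    -- `‖y‖ e + y = ‖y‖ (e - σ₀) = 0` forces `e = σ₀`
    have hy' : y = -(‖y‖ • σ₀) := by
      calc y = ‖y‖ • u := hyu.symm
        _ = ‖y‖ • (-σ₀) := by rw [hu']
        _ = -(‖y‖ • σ₀) := smul_neg _ _
    have h5 : ‖y‖ • (e - σ₀) = 0 := by
      rw [smul_sub, sub_eq_add_neg, ← hy', h']
    rcases smul_eq_zero.1 h5 with h6 | h6
    · exact absurd h6 hny
    · exact sub_eq_zero.1 h6

/-- **HH-6a `HeightHead.AnalyticRadialGauge` (line `height_head` v2, l.894–899), binders VERBATIM.**  For `v` real-analytic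
on `ℝ³`, `T` smooth off `x₀` with `curl v = ∇T × (x − x₀)`, and a unit vector `σ₀`, the explicit radial gauge
`x ↦ T x − T (x₀ + ‖x − x₀‖ • σ₀)` is real-analytic on `{x₀}ᶜ` (great-circle re-gauging `analyticOnNhd_sub_ray` + the base
switch of `exists_unit_off_two_rays`). [folklore] -/
theorem analyticRadialGauge :
    ∀ (v : E3 → E3) (x₀ σ₀ : E3) (T : E3 → ℝ), ‖σ₀‖ = 1 → AnalyticOnNhd ℝ v (univ : Set E3) →
    ContDiffOn ℝ (⊤ : ℕ∞) T ({x₀}ᶜ : Set E3) →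
    (∀ x, curl v x = cross (gradient T x) (x - x₀)) →
    AnalyticOnNhd ℝ (fun x => T x - T (x₀ + ‖x - x₀‖ • σ₀)) ({x₀}ᶜ : Set E3) := by
  intro v x₀ σ₀ T hσ₀ hv hT hω x₁ hx₁
  have hT1 : ContDiffOn ℝ 1 T ({x₀}ᶜ : Set E3) := hT.of_le (by exact_mod_cast le_top)
  have hy₁ : x₁ - x₀ ≠ 0 := sub_ne_zero.2 hx₁
  have hn₁ : ‖x₁ - x₀‖ ≠ 0 := norm_ne_zero_iff.2 hy₁
  obtain ⟨σ₁, hσ₁, hsum, hΩ₁⟩ := exists_unit_off_two_rays σ₀ hy₁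
  -- the ray point `x₀ + ‖y₁‖ σ₁` lies off the antipodal ray of `σ₀`
  set p₁ : E3 := x₀ + ‖x₁ - x₀‖ • σ₁ with hp₁
  have hp₁Ω : ‖p₁ - x₀‖ • σ₀ + (p₁ - x₀) ≠ 0 := by
    have h1 : p₁ - x₀ = ‖x₁ - x₀‖ • σ₁ := by simp [hp₁]
    rw [h1, norm_smul, norm_norm, hσ₁, mul_one, ← smul_add]
    exact smul_ne_zero hn₁ hsum
  -- the three analytic pieces
  have hA := analyticOnNhd_sub_ray hv hT1 hω hσ₁ x₁ hΩ₁
  have hB := analyticOnNhd_sub_ray hv hT1 hω hσ₀ p₁ hp₁Ω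
  have hC : AnalyticAt ℝ (fun x : E3 => x₀ + ‖x - x₀‖ • σ₁) x₁ :=
    (contDiffAt_const.add (((contDiffAt_id.sub contDiffAt_const).norm ℝ hy₁).smul
      contDiffAt_const)).analyticAt
  have hBC := AnalyticAt.comp (g := fun x => T x - T (x₀ + ‖x - x₀‖ • σ₀))
    (f := fun x : E3 => x₀ + ‖x - x₀‖ • σ₁) hB hC
  refine (hA.add hBC).congr (Eventually.of_forall fun x => ?_)
  simp only [Pi.add_apply, comp_apply, add_sub_cancel_left, norm_smul, norm_norm, hσ₁, mul_one]
  ring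

end Summit.NavierStokesRegularity.NavierStokesRegularity.Theorems.PoloidalLiouville.NetFlux
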